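import Literature.NumberTheory.Automorphic.IncompleteEisensteinSeries
import Literature.NumberTheory.EllipticCurves.CuspFormLFunctionProofs
import Mathlib.NumberTheory.LSeries.MellinEqDirichlet
import Mathlib.Analysis.SpecialFunctions.Gaussian.GaussianIntegral
import HarnessLib

/-!
# Rankin–Selberg on `SL₂(ℤ)\ℍ`, I: the horocycle Laplace series, its Dirichlet series, and the
unfolding `∫_𝒟 G · E(·, s) dμ = Γ(s+κ-1) a^{-(s+κ-1)} D(s+κ-1)`

Topic `NumberTheory/Automorphic`; namespace `Literature.NumberTheory.Automorphic`. Proof file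
(theorems only; no definition, no named fact). First analytic brick of an unconditional proof of
the power-saving bound `aₙ(f) ≪ n^{k/2-δ}` for cusp forms on `Γ₀(N)` (Rankin 1939, Selberg 1940)
by the Rankin–Selberg method against the level-one Eisenstein series `E(z, s)` of the tree
(`eisensteinE`, `ModularEisensteinSeries`). The modular input is abstracted into a **horocycle
datum**: a continuous `SL₂(ℤ)`-invariant function `G : ℍ → ℝ` with `0 ≤ G ≤ B` whose horocycle
averages are a Laplace series with non-negative coefficients,

  `∫₀¹ G(x + iy) dx = y^κ L(y)`,  `L(y) = Σₙ Cₙ e^{-a n y}`  (`Cₙ ≥ 0`, `C₀ = 0`, `a > 0`, `κ ≥ 0`)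

(for `G = G_f`, the `SL₂(ℤ)`-trace of `|f|² yᵏ`, `f ∈ S_k(Γ₀(N))`: `κ = k`, `a = 4π/N`,
`Cₙ = Σ_A |cₙ(f|A)|²`; `CuspFormRankinSelbergTrace`). We PROVE:

* `sum_range_le_of_horocycle` — `Σ_{n ≤ X} Cₙ ≤ eᵃ B X^κ` (take `y = 1/X`);
  `summable_div_rpow_of_horocycle`, `LSeriesSummable_of_horocycle` — the Dirichlet series
  `D(w) = Σ Cₙ n^{-w}` converges absolutely for `Re w > κ` (dyadic blocks,
  `summable_div_rpow_of_sum_Ico_le` of the tree);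
* `mellin_laplace_eq` — `∫₀^∞ L(y) y^{w-1} dy = Γ(w) a^{-w} D(w)` for `Re w > κ`
  (Mathlib `hasSum_mellin`);
* `horocycleAverage_le`, `horocycleAverage_le_exp` — `y^κ L(y) ≤ B` and
  `y^κ L(y) ≤ L(1) y^κ e^{-a(y-1)}` (`y ≥ 1`); `integrableOn_rpow_mul_horocycleAverage` —
  `y ↦ y^{σ-2} · y^κ L(y)` is integrable on `(0, ∞)` for `σ > 1`;
* `integrable_indicator_stripFD_cpow_mul` — `𝟙_{S'} (Im w)^s G(w) ∈ L¹(ℍ)` for `Re s > 1`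
  (Tonelli on the strip, `setLIntegral_stripFD_eq`);
* `setIntegral_fd_mul_eisensteinE_eq_mellin` — **the unfolding**
  `∫_𝒟 G(w) E(w, s) dμ(w) = ∫₀^∞ y^κ L(y) y^{s-2} dy` (`Re s > 1`; Iwaniec, *Spectral Methods*,
  §3.2 and (7.4); the tree's `setIntegral_fd_mul_tsum_coset`), and
  `setIntegral_fd_mul_eisensteinE_eq` — **`= Γ(s+κ-1) a^{-(s+κ-1)} D(s+κ-1)`** (Rankin 1939,
  Thm. 1 (i), the integral representation (4.4.2); Zagier 1981, §1 (1)–(3)).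

## References

* R. A. Rankin, Proc. Cambridge Philos. Soc. 35 (1939), 357–372, §4.
* H. Iwaniec, *Spectral Methods of Automorphic Forms*, 2nd ed., GSM 53 (2002), §3.2, §7.1.
* D. Zagier, *The Rankin–Selberg method for automorphic functions which are not of rapid decay*,
  J. Fac. Sci. Univ. Tokyo 28 (1981), 415–437, §1.
-/

noncomputable section

open MeasureTheory Set Filter Real UpperHalfPlane Complex
open scoped Topology MatrixGroups NNReal ENNReal

namespace Literature.NumberTheory.Automorphic

/-! ### The Laplace series `L(y) = Σ Cₙ e^{-a n y}` and the partial sums of its coefficients -/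

section Coefficients

variable {C : ℕ → ℝ} {a B κ : ℝ}

/-- `0 ≤ B` as soon as `Σ Cₙ e^{-a n y} ≤ B y^{-κ}` for some `y > 0` with `Cₙ ≥ 0`. [folklore] -/
theorem nonneg_of_horocycle (hC : ∀ n, 0 ≤ C n)
    (hle : ∀ y : ℝ, 0 < y → ∑' n : ℕ, C n * Real.exp (-a * n * y) ≤ B * y ^ (-κ)) : 0 ≤ B := by
  have h := hle 1 one_pos
  rw [Real.one_rpow, mul_one] at h
  exact (tsum_nonneg fun n ↦ mul_nonneg (hC n) (Real.exp_pos _).le).trans h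

/-- **`Σ_{n ≤ X} Cₙ ≤ eᵃ B X^κ`** for `X ≥ 1`, if `Cₙ ≥ 0` and `Σ Cₙ e^{-a n y} ≤ B y^{-κ}` for all
`y > 0`: take `y = 1/X`, where `e^{-a n/X} ≥ e^{-a}` for `n ≤ X`. [folklore] -/
theorem sum_range_le_of_horocycle (hC : ∀ n, 0 ≤ C n) (ha : 0 < a)
    (hs : ∀ y : ℝ, 0 < y → Summable fun n : ℕ ↦ C n * Real.exp (-a * n * y))
    (hle : ∀ y : ℝ, 0 < y → ∑' n : ℕ, C n * Real.exp (-a * n * y) ≤ B * y ^ (-κ))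
    {X : ℝ} (hX : 1 ≤ X) :
    ∑ n ∈ Finset.range (⌊X⌋₊ + 1), C n ≤ Real.exp a * B * X ^ κ := by
  have hX0 : 0 < X := by linarith
  have hy : 0 < 1 / X := by positivity
  have h1 : ∀ n ∈ Finset.range (⌊X⌋₊ + 1),
      C n ≤ Real.exp a * (C n * Real.exp (-a * n * (1 / X))) := by
    intro n hn
    have hnX : (n : ℝ) ≤ X := by
      have : n ≤ ⌊X⌋₊ := Nat.lt_succ_iff.mp (Finset.mem_range.mp hn)
      exact (Nat.cast_le.mpr this).trans (Nat.floor_le hX0.le)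
    have h2 : 1 ≤ Real.exp a * Real.exp (-a * n * (1 / X)) := by
      rw [← Real.exp_add]
      refine Real.one_le_exp ?_
      have : a * n * (1 / X) ≤ a := by
        rw [mul_one_div, div_le_iff₀ hX0]
        exact mul_le_mul_of_nonneg_left hnX ha.le
      linarith
    calc C n = C n * 1 := (mul_one _).symm
      _ ≤ C n * (Real.exp a * Real.exp (-a * n * (1 / X))) := mul_le_mul_of_nonneg_left h2 (hC n)
      _ = Real.exp a * (C n * Real.exp (-a * n * (1 / X))) := by ring
  calc ∑ n ∈ Finset.range (⌊X⌋₊ + 1), C n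
      ≤ ∑ n ∈ Finset.range (⌊X⌋₊ + 1), Real.exp a * (C n * Real.exp (-a * n * (1 / X))) :=
        Finset.sum_le_sum h1
    _ = Real.exp a * ∑ n ∈ Finset.range (⌊X⌋₊ + 1), C n * Real.exp (-a * n * (1 / X)) := by
        rw [Finset.mul_sum]
    _ ≤ Real.exp a * ∑' n : ℕ, C n * Real.exp (-a * n * (1 / X)) := by
        gcongr
        exact Summable.sum_le_tsum _ (fun n _ ↦ mul_nonneg (hC n) (Real.exp_pos _).le) (hs _ hy)
    _ ≤ Real.exp a * (B * (1 / X) ^ (-κ)) := by gcongr; exact hle _ hy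
    _ = Real.exp a * B * X ^ κ := by
        rw [one_div, Real.inv_rpow hX0.le, Real.rpow_neg hX0.le, inv_inv]; ring

/-- Dyadic blocks: `Σ_{2ʲ ≤ n < 2ʲ⁺¹} Cₙ ≤ (eᵃ B 2^κ) (2ʲ)^κ`. [folklore] -/
theorem sum_Ico_le_of_horocycle (hC : ∀ n, 0 ≤ C n) (ha : 0 < a)
    (hs : ∀ y : ℝ, 0 < y → Summable fun n : ℕ ↦ C n * Real.exp (-a * n * y))
    (hle : ∀ y : ℝ, 0 < y → ∑' n : ℕ, C n * Real.exp (-a * n * y) ≤ B * y ^ (-κ)) (j : ℕ) :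
    ∑ n ∈ Finset.Ico (2 ^ j) (2 ^ (j + 1)), C n ≤ (Real.exp a * B * 2 ^ κ) * ((2 : ℝ) ^ j) ^ κ := by
  have hB := nonneg_of_horocycle hC hle
  have hX : (1 : ℝ) ≤ (2 : ℝ) ^ (j + 1) := one_le_pow₀ (by norm_num)
  have h := sum_range_le_of_horocycle hC ha hs hle hX
  have hfloor : ⌊(2 : ℝ) ^ (j + 1)⌋₊ = 2 ^ (j + 1) := by
    rw [show (2 : ℝ) ^ (j + 1) = ((2 ^ (j + 1) : ℕ) : ℝ) by push_cast; ring, Nat.floor_natCast]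
  rw [hfloor] at h
  calc ∑ n ∈ Finset.Ico (2 ^ j) (2 ^ (j + 1)), C n
      ≤ ∑ n ∈ Finset.range (2 ^ (j + 1) + 1), C n :=
        Finset.sum_le_sum_of_subset_of_nonneg
          (fun n hn ↦ Finset.mem_range.mpr (by
            have := (Finset.mem_Ico.mp hn).2; omega))
          (fun n _ _ ↦ hC n)
    _ ≤ Real.exp a * B * ((2 : ℝ) ^ (j + 1)) ^ κ := h
    _ = (Real.exp a * B * 2 ^ κ) * ((2 : ℝ) ^ j) ^ κ := by
        rw [pow_succ, Real.mul_rpow (by positivity) (by norm_num)]; ring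

/-- **Absolute convergence of the Dirichlet series**: `Σ Cₙ n^{-e} < ∞` for `e > κ`. [folklore] -/
theorem summable_div_rpow_of_horocycle (hC : ∀ n, 0 ≤ C n) (ha : 0 < a)
    (hs : ∀ y : ℝ, 0 < y → Summable fun n : ℕ ↦ C n * Real.exp (-a * n * y))
    (hle : ∀ y : ℝ, 0 < y → ∑' n : ℕ, C n * Real.exp (-a * n * y) ≤ B * y ^ (-κ))
    {e : ℝ} (he : κ < e) : Summable fun n : ℕ ↦ C n / (n : ℝ) ^ e :=
  Literature.NumberTheory.EllipticCurves.ModularForms.summable_div_rpow_of_sum_Ico_le hC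
    (sum_Ico_le_of_horocycle hC ha hs hle) he

/-- The Dirichlet series `D(w) = Σ Cₙ n^{-w}` is `LSeries`-summable for `Re w > κ`. [folklore] -/
theorem LSeriesSummable_of_horocycle (hC : ∀ n, 0 ≤ C n) (ha : 0 < a) (hκ : 0 ≤ κ)
    (hs : ∀ y : ℝ, 0 < y → Summable fun n : ℕ ↦ C n * Real.exp (-a * n * y))
    (hle : ∀ y : ℝ, 0 < y → ∑' n : ℕ, C n * Real.exp (-a * n * y) ≤ B * y ^ (-κ))
    {w : ℂ} (hw : κ < w.re) : LSeriesSummable (fun n ↦ (C n : ℂ)) w := by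
  rw [LSeriesSummable, ← summable_norm_iff]
  have h := summable_div_rpow_of_horocycle hC ha hs hle hw
  refine h.congr fun n ↦ ?_
  rcases Nat.eq_zero_or_pos n with rfl | hn
  · simp [LSeries.term_zero, Real.zero_rpow (by linarith : w.re ≠ 0)]
  · rw [LSeries.norm_term_eq, if_neg hn.ne', Complex.norm_real, Real.norm_of_nonneg (hC n)]

end Coefficients

/-! ### The Mellin transform of the Laplace series -/

section Mellin

variable {C : ℕ → ℝ} {a B κ : ℝ}

/-- **`∫₀^∞ L(y) y^{w-1} dy = Σₙ Γ(w) Cₙ (a n)^{-w}`** for `Re w > κ` (`κ ≥ 0`, `C₀ = 0`; termwise,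
Mathlib `hasSum_mellin`). [folklore] -/
theorem hasSum_mellin_laplace (hC : ∀ n, 0 ≤ C n) (hC0 : C 0 = 0) (ha : 0 < a) (hκ : 0 ≤ κ)
    (hs : ∀ y : ℝ, 0 < y → Summable fun n : ℕ ↦ C n * Real.exp (-a * n * y))
    (hle : ∀ y : ℝ, 0 < y → ∑' n : ℕ, C n * Real.exp (-a * n * y) ≤ B * y ^ (-κ))
    {w : ℂ} (hw : κ < w.re) :
    HasSum (fun n : ℕ ↦ Complex.Gamma w * (C n : ℂ) / ((a * n : ℝ) : ℂ) ^ w)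
      (mellin (fun t : ℝ ↦ ((∑' n : ℕ, C n * Real.exp (-a * n * t) : ℝ) : ℂ)) w) := by
  have hw0 : 0 < w.re := hκ.trans_lt hw
  refine hasSum_mellin (p := fun n : ℕ ↦ a * n) (fun n ↦ ?_) hw0 (fun t ht ↦ ?_) ?_
  · rcases Nat.eq_zero_or_pos n with rfl | hn
    · exact Or.inl (by simp [hC0])
    · exact Or.inr (by positivity)
  · have h := (hs t ht).hasSum
    have h2 := Complex.hasSum_ofReal.mpr h
    simp only [Complex.ofReal_mul, Complex.ofReal_exp] at h2
    convert h2 using 2 with n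
    push_cast
    ring_nf
  · have h := (summable_div_rpow_of_horocycle hC ha hs hle hw).mul_left ((a ^ w.re)⁻¹)
    refine h.congr fun n ↦ ?_
    rw [Complex.norm_real, Real.norm_of_nonneg (hC n), Real.mul_rpow ha.le (Nat.cast_nonneg n)]
    field_simp

/-- **`∫₀^∞ L(y) y^{w-1} dy = Γ(w) a^{-w} D(w)`**, `D(w) = Σ Cₙ n^{-w}`, for `Re w > κ`. [folklore] -/
theorem mellin_laplace_eq (hC : ∀ n, 0 ≤ C n) (hC0 : C 0 = 0) (ha : 0 < a) (hκ : 0 ≤ κ)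
    (hs : ∀ y : ℝ, 0 < y → Summable fun n : ℕ ↦ C n * Real.exp (-a * n * y))
    (hle : ∀ y : ℝ, 0 < y → ∑' n : ℕ, C n * Real.exp (-a * n * y) ≤ B * y ^ (-κ))
    {w : ℂ} (hw : κ < w.re) :
    mellin (fun t : ℝ ↦ ((∑' n : ℕ, C n * Real.exp (-a * n * t) : ℝ) : ℂ)) w =
      Complex.Gamma w * (a : ℂ) ^ (-w) * LSeries (fun n ↦ (C n : ℂ)) w := by
  have h1 := hasSum_mellin_laplace hC hC0 ha hκ hs hle hw
  have h2 : HasSum (fun n : ℕ ↦ Complex.Gamma w * (a : ℂ) ^ (-w) * LSeries.term (fun n ↦ (C n : ℂ)) w n)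
      (Complex.Gamma w * (a : ℂ) ^ (-w) * LSeries (fun n ↦ (C n : ℂ)) w) :=
    (LSeriesSummable_of_horocycle hC ha hκ hs hle hw).hasSum.mul_left _
  refine h1.unique ?_
  convert h2 using 2 with n
  rcases Nat.eq_zero_or_pos n with rfl | hn
  · simp [hC0, LSeries.term_zero]
  · rw [LSeries.term_of_ne_zero hn.ne', Complex.ofReal_mul,
      Complex.mul_cpow_ofReal_nonneg ha.le (Nat.cast_nonneg n), Complex.ofReal_natCast, Complex.cpow_neg]
    have ha' : (a : ℂ) ^ w ≠ 0 := by
      rw [Ne, cpow_eq_zero_iff, not_and_or]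
      exact Or.inl (by exact_mod_cast ha.ne')
    field_simp

end Mellin

/-! ### The horocycle average `m(y) = y^κ L(y)`: bounds and integrability -/

section Average

variable {G : ℍ → ℝ} {C : ℕ → ℝ} {a B κ : ℝ}

/-- `∫₀¹ G(x + iy) dx ≤ B` if `G ≤ B` is continuous. [folklore] -/
theorem horocycleAverage_le (hGc : Continuous G) (hGB : ∀ τ, G τ ≤ B) {y : ℝ} (hy : 0 < y) :
    ∫ x in (0 : ℝ)..1, G (pt x y) ≤ B := by
  have hc : Continuous fun x : ℝ ↦ G (pt x y) := hGc.comp (continuous_pt hy)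
  calc ∫ x in (0 : ℝ)..1, G (pt x y) ≤ ∫ _x in (0 : ℝ)..1, B :=
        intervalIntegral.integral_mono_on zero_le_one (hc.intervalIntegrable _ _)
          (continuous_const.intervalIntegrable _ _) (fun x _ ↦ hGB _)
    _ = B := by simp

/-- `0 ≤ ∫₀¹ G(x + iy) dx` if `G ≥ 0`. [folklore] -/
theorem horocycleAverage_nonneg (hG0 : ∀ τ, 0 ≤ G τ) (y : ℝ) :
    0 ≤ ∫ x in (0 : ℝ)..1, G (pt x y) :=
  intervalIntegral.integral_nonneg zero_le_one fun _ _ ↦ hG0 _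

/-- **Decay of the Laplace series**: `L(y) ≤ e^{-a(y-1)} L(1)` for `y ≥ 1` (`C₀ = 0`, `Cₙ ≥ 0`).
[folklore] -/
theorem laplace_le_exp (hC : ∀ n, 0 ≤ C n) (hC0 : C 0 = 0) (ha : 0 < a)
    (hs : ∀ y : ℝ, 0 < y → Summable fun n : ℕ ↦ C n * Real.exp (-a * n * y))
    {y : ℝ} (hy : 1 ≤ y) :
    ∑' n : ℕ, C n * Real.exp (-a * n * y) ≤
      Real.exp (-a * (y - 1)) * ∑' n : ℕ, C n * Real.exp (-a * n * 1) := by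
  have hy0 : 0 < y := by linarith
  rw [← tsum_mul_left]
  refine Summable.tsum_le_tsum (fun n ↦ ?_) (hs y hy0) ((hs 1 one_pos).mul_left _)
  rcases Nat.eq_zero_or_pos n with rfl | hn
  · simp [hC0]
  · rw [mul_left_comm]
    refine mul_le_mul_of_nonneg_left ?_ (hC n)
    rw [← Real.exp_add]
    refine Real.exp_le_exp.mpr ?_
    have hn1 : (1 : ℝ) ≤ n := by exact_mod_cast hn
    nlinarith [mul_nonneg ha.le (mul_nonneg (sub_nonneg.mpr hy) (sub_nonneg.mpr hn1))]

/-- **Integrability of `y^{σ-2} m(y)` on `(0, ∞)` for `σ > 1`**, where `m(y) = ∫₀¹ G(x+iy) dx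
= y^κ L(y)`: near `0`, `m ≤ B`; near `∞`, `m(y) ≤ L(1) y^κ e^{-a(y-1)}`. [folklore] -/
theorem integrableOn_rpow_mul_horocycleAverage (hGc : Continuous G) (hG0 : ∀ τ, 0 ≤ G τ)
    (hGB : ∀ τ, G τ ≤ B) (hC : ∀ n, 0 ≤ C n) (hC0 : C 0 = 0) (ha : 0 < a) (hκ : 0 ≤ κ)
    (hs : ∀ y : ℝ, 0 < y → Summable fun n : ℕ ↦ C n * Real.exp (-a * n * y))
    (hm : ∀ y : ℝ, 0 < y → ∫ x in (0 : ℝ)..1, G (pt x y) = y ^ κ * ∑' n : ℕ, C n * Real.exp (-a * n * y))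
    {σ : ℝ} (hσ : 1 < σ) :
    IntegrableOn (fun y : ℝ ↦ y ^ (σ - 2) * ∫ x in (0 : ℝ)..1, G (pt x y)) (Ioi 0) := by
  have hcont : ContinuousOn (fun y : ℝ ↦ y ^ (σ - 2) * ∫ x in (0 : ℝ)..1, G (pt x y)) (Ioi 0) := by
    refine ContinuousOn.mul (fun y hy ↦ ?_) (continuousOn_intervalIntegral_pt hGc)
    exact (Real.continuousAt_rpow_const _ _ (Or.inl (ne_of_gt hy))).continuousWithinAt
  have hmeas : AEStronglyMeasurable (fun y : ℝ ↦ y ^ (σ - 2) * ∫ x in (0 : ℝ)..1, G (pt x y))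
      (volume.restrict (Ioi 0)) := hcont.aestronglyMeasurable measurableSet_Ioi
  rw [← Ioc_union_Ioi_eq_Ioi zero_le_one, integrableOn_union]
  constructor
  · -- on `(0, 1]`: bounded by `B y^{σ-2}`
    have h1 : IntegrableOn (fun y : ℝ ↦ B * y ^ (σ - 2)) (Ioc 0 1) := by
      refine Integrable.const_mul ?_ B
      exact (intervalIntegral.intervalIntegrable_rpow' (by linarith : -1 < σ - 2)).1
    refine Integrable.mono' h1 (hmeas.mono_measure (Measure.restrict_mono Ioc_subset_Ioi_self le_rfl)) ?_
    refine (ae_restrict_iff' measurableSet_Ioc).mpr (ae_of_all _ fun y hy ↦ ?_)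
    have hy0 : 0 < y := hy.1
    rw [Real.norm_of_nonneg (mul_nonneg (Real.rpow_nonneg hy0.le _) (horocycleAverage_nonneg hG0 y)),
      mul_comm]
    exact mul_le_mul_of_nonneg_right (horocycleAverage_le hGc hGB hy0) (Real.rpow_nonneg hy0.le _)
  · -- on `(1, ∞)`: bounded by `L(1) e^{a} y^{σ-2+κ} e^{-a y}`
    set L1 : ℝ := ∑' n : ℕ, C n * Real.exp (-a * n * 1) with hL1
    have hL1_0 : 0 ≤ L1 := tsum_nonneg fun n ↦ mul_nonneg (hC n) (Real.exp_pos _).le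
    have h2 : IntegrableOn (fun y : ℝ ↦ (L1 * Real.exp a) * (y ^ (σ - 2 + κ) * Real.exp (-a * y ^ (1 : ℝ))))
        (Ioi 1) := by
      refine Integrable.const_mul ?_ _
      exact (integrableOn_rpow_mul_exp_neg_mul_rpow (by linarith : -1 < σ - 2 + κ) le_rfl ha).mono_set
        (Ioi_subset_Ioi zero_le_one)
    refine Integrable.mono' h2 (hmeas.mono_measure (Measure.restrict_mono (Ioi_subset_Ioi zero_le_one) le_rfl)) ?_
    refine (ae_restrict_iff' measurableSet_Ioi).mpr (ae_of_all _ fun y hy ↦ ?_)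
    have hy1 : (1 : ℝ) < y := hy
    have hy0 : 0 < y := by linarith
    rw [Real.norm_of_nonneg (mul_nonneg (Real.rpow_nonneg hy0.le _) (horocycleAverage_nonneg hG0 y)),
      hm y hy0, Real.rpow_one]
    have hL := laplace_le_exp hC hC0 ha hs hy1.le
    calc y ^ (σ - 2) * (y ^ κ * ∑' n : ℕ, C n * Real.exp (-a * n * y))
        ≤ y ^ (σ - 2) * (y ^ κ * (Real.exp (-a * (y - 1)) * L1)) := by gcongr
      _ = (L1 * Real.exp a) * (y ^ (σ - 2 + κ) * Real.exp (-a * y)) := by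
          rw [Real.rpow_add hy0, show -a * (y - 1) = -a * y + a by ring, Real.exp_add]; ring

end Average

/-! ### Integrability on the strip and the unfolding against `E(z, s)` -/

section Unfolding

variable {G : ℍ → ℝ} {C : ℕ → ℝ} {a B κ : ℝ}

/-- `‖(Im w)^s‖ = (Im w)^{Re s}`. [folklore] -/
theorem norm_im_cpow (w : ℍ) (s : ℂ) : ‖((w.im : ℝ) : ℂ) ^ s‖ = w.im ^ s.re :=
  Complex.norm_cpow_eq_rpow_re_of_pos w.im_pos _

/-- The summands of `2E(w, s)`: `(Im γ_v w)^s = (Im w / |cw + d|²)^s`. [folklore] -/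
theorem im_rowRep_cpow_eq_esTerm (s : ℂ) (v : EisensteinSeries.gammaSet 1 1 0) (w : ℍ) :
    (((rowRep v • w).im : ℝ) : ℂ) ^ s = esTerm s v w := by
  rw [im_rowRep_smul_eq, esTerm, Complex.normSq_eq_norm_sq]

/-- `Σ_v (Im γ_v w)^s = 2 E(w, s)`. [folklore] -/
theorem tsum_im_rowRep_cpow (s : ℂ) (w : ℍ) :
    ∑' v : EisensteinSeries.gammaSet 1 1 0, (((rowRep v • w).im : ℝ) : ℂ) ^ s = 2 * eisensteinE w s := by
  simp_rw [im_rowRep_cpow_eq_esTerm]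
  rw [eisensteinE]
  ring

/-- **`𝟙_{S'}(w) (Im w)^s G(w)` is integrable on `ℍ` for `Re s > 1`** (`G` a horocycle datum):
by Tonelli on the strip its `L¹`-norm is `∫₀^∞ y^{Re s - 2} m(y) dy < ∞`
(`integrableOn_rpow_mul_horocycleAverage`). [folklore] -/
theorem integrable_indicator_stripFD_cpow_mul (hGc : Continuous G) (hG0 : ∀ τ, 0 ≤ G τ)
    (hGB : ∀ τ, G τ ≤ B) (hC : ∀ n, 0 ≤ C n) (hC0 : C 0 = 0) (ha : 0 < a) (hκ : 0 ≤ κ)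
    (hs : ∀ y : ℝ, 0 < y → Summable fun n : ℕ ↦ C n * Real.exp (-a * n * y))
    (hm : ∀ y : ℝ, 0 < y → ∫ x in (0 : ℝ)..1, G (pt x y) = y ^ κ * ∑' n : ℕ, C n * Real.exp (-a * n * y))
    {s : ℂ} (hs1 : 1 < s.re) :
    Integrable fun w : ℍ ↦ stripFD.indicator (fun _ ↦ (1 : ℂ)) w * ((w.im : ℝ) : ℂ) ^ s * (G w : ℂ) := by
  set F : ℍ → ℂ := fun w ↦ ((w.im : ℝ) : ℂ) ^ s * (G w : ℂ) with hF
  have hFc : Continuous F := by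
    refine Continuous.mul ?_ (Complex.continuous_ofReal.comp hGc)
    refine Continuous.cpow (Complex.continuous_ofReal.comp UpperHalfPlane.continuous_im)
      continuous_const fun w ↦ Or.inl ?_
    simp [w.im_pos]
  have he : (fun w : ℍ ↦ stripFD.indicator (fun _ ↦ (1 : ℂ)) w * ((w.im : ℝ) : ℂ) ^ s * (G w : ℂ)) =
      stripFD.indicator F := by
    funext w
    by_cases hw : w ∈ stripFD
    · simp [Set.indicator_of_mem hw, hF]
    · simp [Set.indicator_of_notMem hw]
  rw [he, integrable_indicator_iff measurableSet_stripFD]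
  refine ⟨hFc.aestronglyMeasurable.restrict, ?_⟩
  -- the `L¹` norm by Tonelli on the strip
  rw [HasFiniteIntegral, ← lintegral_indicator measurableSet_stripFD]
  have hmeasE : Measurable fun w : ℍ ↦ ‖F w‖ₑ := hFc.measurable.enorm
  have h1 : ∫⁻ w, stripFD.indicator (fun w ↦ ‖F w‖ₑ) w = ∫⁻ w in stripFD, ‖F w‖ₑ :=
    lintegral_indicator measurableSet_stripFD _
  rw [h1, setLIntegral_stripFD_eq _ hmeasE]
  -- evaluate the inner integrals
  have hinner : ∀ y ∈ Ioi (0 : ℝ), (∫⁻ x in Ico (0 : ℝ) 1, ‖F (pt x y)‖ₑ) * ENNReal.ofReal ((y ^ 2)⁻¹) =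
      ENNReal.ofReal (y ^ (s.re - 2) * ∫ x in (0 : ℝ)..1, G (pt x y)) := by
    intro y hy
    have hy0 : (0 : ℝ) < y := hy
    have hnorm : ∀ x : ℝ, ‖F (pt x y)‖ₑ = ENNReal.ofReal (y ^ s.re * G (pt x y)) := by
      intro x
      rw [← ofReal_norm, hF]
      dsimp only
      rw [norm_mul, norm_im_cpow, pt_im hy0, Complex.norm_real, Real.norm_of_nonneg (hG0 _)]
    simp_rw [hnorm]
    have hGi : IntegrableOn (fun x : ℝ ↦ y ^ s.re * G (pt x y)) (Ico 0 1) :=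
      ((hGc.comp (continuous_pt hy0)).const_mul _).integrableOn_Icc.mono_set Ico_subset_Icc_self
    rw [← ofReal_integral_eq_lintegral_ofReal hGi (ae_of_all _ fun x ↦ mul_nonneg
        (Real.rpow_nonneg hy0.le _) (hG0 _)), ← ENNReal.ofReal_mul' (by positivity),
      integral_const_mul, integral_Ico_eq_integral_Ioc, ← intervalIntegral.integral_of_le zero_le_one]
    congr 1
    rw [show s.re - 2 = s.re + (-2 : ℝ) by ring, Real.rpow_add hy0,
      show y ^ (-2 : ℝ) = (y ^ 2)⁻¹ by rw [Real.rpow_neg hy0.le, Real.rpow_two]]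
    ring
  rw [setLIntegral_congr_fun measurableSet_Ioi hinner]
  have hint := integrableOn_rpow_mul_horocycleAverage hGc hG0 hGB hC hC0 ha hκ hs hm hs1
  have h2 := hint.2
  rw [HasFiniteIntegral] at h2
  refine lt_of_le_of_lt (lintegral_mono fun y ↦ ?_) h2
  rw [Real.enorm_eq_ofReal_abs]
  exact ENNReal.ofReal_le_ofReal (le_abs_self _)

/-- **Unfolding `E(z, s)` against an `SL₂(ℤ)`-invariant function** (Iwaniec, *Spectral Methods*,
§3.2 and (7.4); Rankin 1939, §4): for a horocycle datum `G` and `Re s > 1`,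
`∫_𝒟 G(w) E(w, s) dμ(w) = ∫₀^∞ (∫₀¹ G(x+iy) dx) y^{s-2} dy = mellin m (s - 1)`.
[cite: Rankin1939, §4] -/
theorem setIntegral_fd_mul_eisensteinE_eq_mellin (hGc : Continuous G)
    (hGinv : ∀ (A : SL(2, ℤ)) (τ : ℍ), G (A • τ) = G τ) (hG0 : ∀ τ, 0 ≤ G τ)
    (hGB : ∀ τ, G τ ≤ B) (hC : ∀ n, 0 ≤ C n) (hC0 : C 0 = 0) (ha : 0 < a) (hκ : 0 ≤ κ)
    (hs : ∀ y : ℝ, 0 < y → Summable fun n : ℕ ↦ C n * Real.exp (-a * n * y))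
    (hm : ∀ y : ℝ, 0 < y → ∫ x in (0 : ℝ)..1, G (pt x y) = y ^ κ * ∑' n : ℕ, C n * Real.exp (-a * n * y))
    {s : ℂ} (hs1 : 1 < s.re) :
    ∫ w in ModularGroup.fd, (G w : ℂ) * eisensteinE w s =
      mellin (fun y : ℝ ↦ ((∫ x in (0 : ℝ)..1, G (pt x y) : ℝ) : ℂ)) (s - 1) := by
  -- the tree's unfolding lemma with `u = G`, `Ψ = (Im ·)^s`
  have hua : IsAutomorphic (𝒮ℒ : Subgroup (GL (Fin 2) ℝ)) (fun w ↦ (G w : ℂ)) := by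
    rintro γ ⟨A, rfl⟩ z
    simp only
    rw [show (Matrix.SpecialLinearGroup.mapGL ℝ A : GL (Fin 2) ℝ) • z = A • z from rfl, hGinv]
  have hΨ : ∀ (n : ℤ) (w : ℍ), ((((n : ℝ) +ᵥ w).im : ℝ) : ℂ) ^ s = ((w.im : ℝ) : ℂ) ^ s := by
    intro n w; rw [UpperHalfPlane.vadd_im]
  have hsum : ∀ w : ℍ, Summable fun v : EisensteinSeries.gammaSet 1 1 0 ↦
      ‖(((rowRep v • w).im : ℝ) : ℂ) ^ s‖ := by
    intro w
    simp_rw [im_rowRep_cpow_eq_esTerm]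
    exact (summable_esTerm hs1 w).norm
  have hint := integrable_indicator_stripFD_cpow_mul hGc hG0 hGB hC hC0 ha hκ hs hm hs1
  have h := setIntegral_fd_mul_tsum_coset (u := fun w ↦ (G w : ℂ)) (Ψ := fun w ↦ ((w.im : ℝ) : ℂ) ^ s)
    hua hΨ hsum hint
  simp_rw [tsum_im_rowRep_cpow] at h
  -- left-hand side
  have hL : ∫ w in ModularGroup.fd, (G w : ℂ) * (2 * eisensteinE w s) =
      2 * ∫ w in ModularGroup.fd, (G w : ℂ) * eisensteinE w s := by
    rw [← integral_const_mul]
    refine setIntegral_congr_fun ModularGroup.isClosed_fd.measurableSet fun w _ ↦ ?_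
    ring
  -- right-hand side: Fubini on the strip
  have hF : IntegrableOn (fun w : ℍ ↦ ((w.im : ℝ) : ℂ) ^ s * (G w : ℂ)) stripFD volume := by
    rw [← integrable_indicator_iff measurableSet_stripFD]
    refine hint.congr (Eventually.of_forall fun w ↦ ?_)
    by_cases hw : w ∈ stripFD
    · simp [Set.indicator_of_mem hw]
    · simp [Set.indicator_of_notMem hw]
  have hR : ∫ w in stripFD, ((w.im : ℝ) : ℂ) ^ s * (G w : ℂ) =
      mellin (fun y : ℝ ↦ ((∫ x in (0 : ℝ)..1, G (pt x y) : ℝ) : ℂ)) (s - 1) := by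
    rw [setIntegral_stripFD_eq hF, mellin]
    refine setIntegral_congr_fun measurableSet_Ioi fun y hy ↦ ?_
    have hy0 : (0 : ℝ) < y := hy
    have hyc : (y : ℂ) ≠ 0 := by exact_mod_cast hy0.ne'
    have hinner : ∫ x in Ico (0 : ℝ) 1, (((pt x y).im : ℝ) : ℂ) ^ s * (G (pt x y) : ℂ) =
        ((y : ℝ) : ℂ) ^ s * ((∫ x in (0 : ℝ)..1, G (pt x y) : ℝ) : ℂ) := by
      simp_rw [pt_im hy0]
      rw [integral_const_mul, integral_Ico_eq_integral_Ioc, ← intervalIntegral.integral_of_le zero_le_one,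
        intervalIntegral.integral_ofReal]
    rw [hinner, Complex.real_smul, ← mul_assoc]
    congr 1
    rw [show s - 1 - 1 = s + (-2 : ℂ) by ring, Complex.cpow_add _ _ hyc, Complex.cpow_neg,
      Complex.cpow_two]
    push_cast
    ring
  rw [hL, hR] at h
  have h2 : (2 : ℂ) ≠ 0 := two_ne_zero
  exact mul_left_cancel₀ h2 h

/-- **The Rankin–Selberg identity on `Re s > 1`** (Rankin 1939, Thm. 1 (i), (4.4.2); Zagier 1981,
§1 (3)): for a horocycle datum,
`∫_𝒟 G(w) E(w, s) dμ(w) = Γ(s + κ - 1) a^{-(s+κ-1)} D(s + κ - 1)`, `D(w) = Σ Cₙ n^{-w}`.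
[cite: Rankin1939, §4] -/
theorem setIntegral_fd_mul_eisensteinE_eq (hGc : Continuous G)
    (hGinv : ∀ (A : SL(2, ℤ)) (τ : ℍ), G (A • τ) = G τ) (hG0 : ∀ τ, 0 ≤ G τ)
    (hGB : ∀ τ, G τ ≤ B) (hC : ∀ n, 0 ≤ C n) (hC0 : C 0 = 0) (ha : 0 < a) (hκ : 0 ≤ κ)
    (hs : ∀ y : ℝ, 0 < y → Summable fun n : ℕ ↦ C n * Real.exp (-a * n * y))
    (hle : ∀ y : ℝ, 0 < y → ∑' n : ℕ, C n * Real.exp (-a * n * y) ≤ B * y ^ (-κ))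
    (hm : ∀ y : ℝ, 0 < y → ∫ x in (0 : ℝ)..1, G (pt x y) = y ^ κ * ∑' n : ℕ, C n * Real.exp (-a * n * y))
    {s : ℂ} (hs1 : 1 < s.re) :
    ∫ w in ModularGroup.fd, (G w : ℂ) * eisensteinE w s =
      Complex.Gamma (s + κ - 1) * (a : ℂ) ^ (-(s + κ - 1)) * LSeries (fun n ↦ (C n : ℂ)) (s + κ - 1) := by
  rw [setIntegral_fd_mul_eisensteinE_eq_mellin hGc hGinv hG0 hGB hC hC0 ha hκ hs hm hs1]
  have hw : κ < (s + κ - 1).re := by simp; linarith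
  rw [← mellin_laplace_eq hC hC0 ha hκ hs hle hw, show s + κ - 1 = (s - 1) + (κ : ℂ) by ring,
    ← mellin_cpow_smul]
  refine setIntegral_congr_fun measurableSet_Ioi fun y hy ↦ ?_
  have hy0 : (0 : ℝ) < y := hy
  simp only [smul_eq_mul]
  rw [hm y hy0, Complex.ofReal_mul, Complex.ofReal_cpow hy0.le]

end Unfolding

end Literature.NumberTheory.Automorphic

end
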